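import Summits.CriticalPhenomena.PercolationContinuityZ3.Theorems.PercNearOneGluingNoHeavyQuantFarSunCondition
import Summits.CriticalPhenomena.PercolationContinuityZ3.Theorems.PercNearOneGluingNoHeavyQuantFarSunLawSums
import HarnessLib

/-!
# FAR beyond trees: `SunFAR K j` from a HAIR-ONLY ("half") certificate — the arm-free reduction

builds on p205010 (kernel theorem, internal audit signed; external expert review pending)

Support file (`--supports stmt-CriticalPhenomena-4575`), seat `prim-cert-1` (gen 32); memo `prim-cert-1/FROM-prim-cert-1-g32-HAIR-ONLY.md`.

Conditioning `sunLaw` on the closed extent `(l, l')` of the cycle (`HairyCycle.sunLaw_eq_sum_hairW_mul_one`, `HairyCycle.sunLaw_one_eq`)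
writes the upper tail as an `arcW`-mixture of HAIR-ONLY quantities:
`sunLaw K g h (j+1 ≤ #·) = Σ_{(l,l') ∈ arcIx K} arcW K g l l' · hairV K h j (cov K l l')`, where
`hairV K h j C = Σ_{Q ⊆ range K} hairW K h Q · 𝟙[j+1 ≤ #(Q ∩ C)]` is the probability that at least `j+1` of the independent hairs
indexed by `C` are open (`HairyCycle.hairV`, `HairyCycle.sunLaw_tail_eq_sum_arcW_hairV`).  Likewise the marginals:
`sunMarg K g h k = h k · Σ_{(l,l') : k ∈ cov} arcW K g l l'` (`HairyCycle.sum_arcW_ite_mem_cov`).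

* **a hair-only certificate** (the hypothesis of `HairyCycle.sunFAR_of_hairCert`): for every `g, h ∈ [0,1]` with `2j < Σ_k sunMarg k` there are weights
  `λ_k ≥ 0` (`Σ_{k<K} λ_k = 1`) and a deficit multiplier `μ ≥ 0` with, for EVERY closed extent `(l,l') ∈ arcIx K` (coverage set
  `C = cov K l l'`, a prefix-plus-suffix of the positions):  `Σ_{k∈C} λ_k h_k + μ·(Σ_{k∈C} h_k − 2j) ≤ hairV K h j C`.
  (The certificate may depend on `g` and `h`; it never mentions the joint law of the two arms.)
* **`HairyCycle.sunFAR_of_hairCert`** — such a certificate gives `SunFAR K j` (`K ≥ 2`): multiply the certificate rows by `arcW ≥ 0` and sum: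
  `sunLaw (j+1 ≤ #·) ≥ Σ_k λ_k · sunMarg k + μ·(EN − 2j) ≥ min_k sunMarg k`.
Why this matters (memo §1–§3): by LP duality a hair-only certificate at `h` says FAR holds at `h` for EVERY (even dependent) joint law of the two arms;
numerically such certificates exist for all `h` exactly when `K ≥ 3j+1` (tight cases: the clockwise sojourn weights of
`Quant.CountDP.sojourn_weighted`), so the all-`K` programme for layers `j = 2, 3` reduces to a hair-only family for `K ≥ 7`, `K ≥ 10`
(the kernel has every `K ≤ 10`).  No sorries; standard axioms.  Elementary [this work].
[cite: KozmaNitzan2024, Conjecture 3 (p. 15)] (context: the lower-tail family FAR serves).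
-/

noncomputable section

namespace Summit.CriticalPhenomena.PercolationContinuityZ3.Theorems.HairyCycle

open Finset
open scoped Classical

variable {K : ℕ}

/-! ## The hair-only value of a coverage set and the certificate -/

/-- **Hair-only upper tail on a coverage set**: `hairV K h j C = Σ_{Q ⊆ range K} hairW K h Q · 𝟙[j+1 ≤ #(Q ∩ C)]` — for `h ∈ [0,1]`
the probability that at least `j+1` of the independent hairs (hair `k` open with probability `h k`) with index in `C` are open. [this work] -/
def hairV (K : ℕ) (h : ℕ → ℝ) (j : ℕ) (C : Finset ℕ) : ℝ :=
  ∑ Q ∈ (range K).powerset, hairW K h Q * (if j + 1 ≤ (Q ∩ C).card then 1 else 0)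

/-! ## Conditioning on the closed extent -/

/-- **Tail = arcW-mixture of hair-only tails**: `sunLaw K g h (j+1 ≤ #·) = Σ_{p ∈ arcIx K} arcW K g p.1 p.2 · hairV K h j (cov K p.1 p.2)`
(every real `g`, `h`). [this work] -/
theorem sunLaw_tail_eq_sum_arcW_hairV (g h : ℕ → ℝ) (j : ℕ) :
    sunLaw K g h (fun R => j + 1 ≤ R.card) = ∑ p ∈ arcIx K, arcW K g p.1 p.2 * hairV K h j (cov K p.1 p.2) := by
  rw [sunLaw_eq_sum_hairW_mul_one]
  simp only [sunLaw_one_eq, hairV, Finset.mul_sum]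
  rw [Finset.sum_comm]
  refine Finset.sum_congr rfl fun p _ => Finset.sum_congr rfl fun Q _ => ?_
  ring

/-- A sum over a coverage set as an indicator sum over `range K`. [this work] -/
theorem sum_cov_eq_sum_range_ite (l l' : ℕ) (f : ℕ → ℝ) :
    ∑ k ∈ cov K l l', f k = ∑ k ∈ range K, if k ∈ cov K l l' then f k else 0 := by
  unfold cov
  rw [Finset.sum_filter]
  refine Finset.sum_congr rfl fun k hk => ?_
  simp only [Finset.mem_filter, hk, true_and]

/-- **Marginal = `h k` × arc mass covering `k`**: `Σ_{p ∈ arcIx K} arcW K g p.1 p.2 · 𝟙[k ∈ cov K p.1 p.2] · h k = sunMarg K g h k`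
(`k < K`, `g ∈ [0,1]`). [this work] -/
theorem sum_arcW_ite_mem_cov (hK : 2 ≤ K) {g : ℕ → ℝ} (hg : ∀ m, m ≤ K → 0 ≤ g m ∧ g m ≤ 1) (h : ℕ → ℝ) {k : ℕ} (hk : k < K) :
    (∑ p ∈ arcIx K, arcW K g p.1 p.2 * (if k ∈ cov K p.1 p.2 then 1 else 0)) * h k = sunMarg K g h k := by
  have h1 : ∑ p ∈ arcIx K, arcW K g p.1 p.2 * (if k ∈ cov K p.1 p.2 then (1 : ℝ) else 0) =
      sunLaw K g (fun _ => (1 : ℝ)) (fun R => k ∈ R) := by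
    rw [sunLaw_one_eq]
    refine Finset.sum_congr rfl fun p _ => ?_
    split_ifs <;> rfl
  rw [h1, sunLaw_mem_eq_sunMarg hK hg (fun _ _ => ⟨zero_le_one, le_rfl⟩) hk]
  unfold sunMarg
  ring

/-- Total arc mass: `Σ_{p ∈ arcIx K} arcW K g p.1 p.2 = 1` (every real `g`). [this work] -/
theorem sum_arcW_eq_one (g : ℕ → ℝ) : ∑ p ∈ arcIx K, arcW K g p.1 p.2 = 1 := by
  have h1 := sunLaw_one_eq (K := K) g (fun _ => True)
  rw [sunLaw_true'] at h1
  rw [h1]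
  refine Finset.sum_congr rfl fun p _ => ?_
  rw [if_pos trivial, mul_one]

/-- Mixing an additive row over the closed extents: `Σ_p arcW p · Σ_{k ∈ cov p} f k · h k = Σ_{k<K} f k · sunMarg k`. [this work] -/
theorem sum_arcW_mul_sum_cov (hK : 2 ≤ K) {g : ℕ → ℝ} (hg : ∀ m, m ≤ K → 0 ≤ g m ∧ g m ≤ 1) (h f : ℕ → ℝ) :
    ∑ p ∈ arcIx K, arcW K g p.1 p.2 * ∑ k ∈ cov K p.1 p.2, f k * h k = ∑ k ∈ range K, f k * sunMarg K g h k := by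
  simp only [sum_cov_eq_sum_range_ite, Finset.mul_sum]
  rw [Finset.sum_comm]
  refine Finset.sum_congr rfl fun k hk => ?_
  rw [← sum_arcW_ite_mem_cov hK hg h (Finset.mem_range.1 hk), Finset.sum_mul, Finset.mul_sum]
  refine Finset.sum_congr rfl fun p _ => ?_
  split_ifs <;> ring

/-! ## The reduction -/

/-- **`SunFAR K j` FROM A HAIR-ONLY CERTIFICATE** (`K ≥ 2`): if for every `g, h ∈ [0,1]` with `2j < EN` some `λ ≥ 0` (`Σ λ = 1`), `μ ≥ 0`
satisfy `Σ_{k∈C} λ_k h_k + μ(Σ_{k∈C} h_k − 2j) ≤ hairV K h j C` on every coverage set `C = cov K l l'`, then `SunFAR K j`: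
`P(N ≥ j+1) = Σ_p arcW_p · hairV(cov p) ≥ Σ_k λ_k sunMarg k + μ(EN − 2j) ≥ min_k sunMarg k`. [this work] -/
theorem sunFAR_of_hairCert (hK : 2 ≤ K) {j : ℕ}
    (hc : ∀ g h : ℕ → ℝ, (∀ m, m ≤ K → 0 ≤ g m ∧ g m ≤ 1) → (∀ k, k < K → 0 ≤ h k ∧ h k ≤ 1) →
      (2 * j : ℝ) < ∑ k ∈ range K, sunMarg K g h k →
      ∃ lam : ℕ → ℝ, ∃ μ : ℝ, (∀ k, 0 ≤ lam k) ∧ ∑ k ∈ range K, lam k = 1 ∧ 0 ≤ μ ∧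
        ∀ p ∈ arcIx K, ∑ k ∈ cov K p.1 p.2, lam k * h k + μ * (∑ k ∈ cov K p.1 p.2, h k - 2 * j) ≤
          hairV K h j (cov K p.1 p.2)) :
    SunFAR K j := by
  rw [sunFAR_iff_tail hK]
  intro g h hg hh hEN x hx
  obtain ⟨lam, μ, hlam, hsum, hμ, hrows⟩ := hc g h hg hh hEN
  rw [sunLaw_tail_eq_sum_arcW_hairV]
  -- the certificate rows, mixed with the nonnegative arc masses
  have hmix : ∑ p ∈ arcIx K, arcW K g p.1 p.2 *
      (∑ k ∈ cov K p.1 p.2, lam k * h k + μ * (∑ k ∈ cov K p.1 p.2, h k - 2 * j)) ≤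
      ∑ p ∈ arcIx K, arcW K g p.1 p.2 * hairV K h j (cov K p.1 p.2) :=
    Finset.sum_le_sum fun p hp => mul_le_mul_of_nonneg_left (hrows p hp) (arcW_nonneg hg _ _)
  -- evaluate the mixed rows: Σ_k λ_k sunMarg_k + μ (EN − 2j)
  have hone : ∀ p ∈ arcIx K, ∑ k ∈ cov K p.1 p.2, h k = ∑ k ∈ cov K p.1 p.2, (1 : ℝ) * h k :=
    fun p _ => Finset.sum_congr rfl fun k _ => (one_mul _).symm
  have heval : ∑ p ∈ arcIx K, arcW K g p.1 p.2 *
      (∑ k ∈ cov K p.1 p.2, lam k * h k + μ * (∑ k ∈ cov K p.1 p.2, h k - 2 * j)) =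
      ∑ k ∈ range K, lam k * sunMarg K g h k + μ * (∑ k ∈ range K, sunMarg K g h k - 2 * j) := by
    have hsplit : ∀ p ∈ arcIx K, arcW K g p.1 p.2 *
        (∑ k ∈ cov K p.1 p.2, lam k * h k + μ * (∑ k ∈ cov K p.1 p.2, h k - 2 * j)) =
        arcW K g p.1 p.2 * ∑ k ∈ cov K p.1 p.2, lam k * h k +
          μ * (arcW K g p.1 p.2 * ∑ k ∈ cov K p.1 p.2, (1 : ℝ) * h k) - 2 * j * μ * arcW K g p.1 p.2 := by
      intro p hp
      rw [← hone p hp]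
      ring
    rw [Finset.sum_congr rfl hsplit, Finset.sum_sub_distrib, Finset.sum_add_distrib, ← Finset.mul_sum, ← Finset.mul_sum,
      sum_arcW_mul_sum_cov hK hg h lam, sum_arcW_mul_sum_cov hK hg h (fun _ => (1 : ℝ)), sum_arcW_eq_one]
    have h1 : ∑ k ∈ range K, (1 : ℝ) * sunMarg K g h k = ∑ k ∈ range K, sunMarg K g h k :=
      Finset.sum_congr rfl fun k _ => one_mul _
    rw [h1]
    ring
  -- the mixed rows dominate `x`
  have hx' : x ≤ ∑ k ∈ range K, lam k * sunMarg K g h k + μ * (∑ k ∈ range K, sunMarg K g h k - 2 * j) := by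
    have h1 : ∑ k ∈ range K, lam k * x ≤ ∑ k ∈ range K, lam k * sunMarg K g h k :=
      Finset.sum_le_sum fun k hk => mul_le_mul_of_nonneg_left (hx k (Finset.mem_range.1 hk)) (hlam k)
    rw [← Finset.sum_mul, hsum, one_mul] at h1
    have h2 : 0 ≤ μ * (∑ k ∈ range K, sunMarg K g h k - 2 * j) := mul_nonneg hμ (by linarith)
    linarith
  linarith [hmix, heval, hx']

end Summit.CriticalPhenomena.PercolationContinuityZ3.Theorems.HairyCycle

end
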